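import Summits.CriticalPhenomena.PercolationContinuityZ3.Theorems.Transplant.KNCells2Cover
import Summits.CriticalPhenomena.PercolationContinuityZ3.Theorems.Transplant.KNCellsBoxProdZ2
import Summits.CriticalPhenomena.PercolationContinuityZ3.Theorems.Transplant.ProdBoxes
import HarnessLib

/-!
# The `X □ ℤ²` instance of the LAG-1 geometry hypotheses of the node theorem `KNCells.KSchA.samePWitnessAt_of_kit₂'`
# (`AnchGeom`, `SepGeom₂`, the envelope bound `hB`, the degree bound `hΔ`) for p3-g2's anchored cells `BoxProdZ2.cellGeom`

builds on p205010 (kernel theorem, internal audit signed; external expert review pending) — nothing in this file uses p205010.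
Lane `prim-bschramm`, seat `prim-bschramm-stmt` (gen 3; claimed 11:46Z, cc p2-g2 / p3-g2); helper file (`--supports stmt-CriticalPhenomena-4575`).

The single target for the instances, `KNCells2WitnessLevel.samePWitnessAt_of_kit₂'` (p2-g2, lag-1 anchors, F8-DESIGN §7), asks of the
cell geometry `Γ`: `RunGeom`, `AnchGeom`, `SepGeom₂`, `ExitGeom`, `StepsGeom`, `LevelGeom`, a degree bound `hΔ` and a UNIFORM bound `hB` on the
envelope regions `envRegion₂ h e a a'` over all histories, macro-edges and all pairs of anchors.  p3-g2's `KNCellsBoxProdZ2` supplies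
`runGeom / sepGeom / exitGeom / stepsGeom` for `Γ = cellGeom X C R a₀ anchor hanch` (cells `B_X(anchor, ·) × (planar KN cell)`, admissible
anchors `anchSet a v = B_X(a, R)`).  This file adds the lag-1 items:
* `anchGeom` — `a ∈ B_X(a, R)` and `anchSet a v` does not depend on `v`;
* `sepGeom₂` — the two cross-anchor containments `Q^a_x = B(a,2R) × Q_x ⊆ B(a',3R) × Cell_x = Cell^{a'}_x` and
  `Btw^a_{v,δ} = B(a,R) × Btw ⊆ Cell^a_v ∪ Cell^{a'}_{v+δ}` for `a' ∈ B(a, R)` (ball symmetry + triangle inequality);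
* `card_envRegion₂_le` — `#envRegion₂ h e a a' ≤ (Δ+1)^{2R}(70r+1)² + 4(Δ+1)^R((10r+1)² + (70r+1)²)` for EVERY `a a'` (the envelope region is `E^a_{w,δ} ∪ ⋃_{du} Stub^{a'}`, two
  fibre balls of bounded size times planar sets inside squares of half-width `35 r`), and `exists_card_envRegion₂_le`;
* `degree_le` — `deg (X □ ℤ²) ≤ Δ + 4` (p2's `ProdKN.degree_prod_le`, re-exported in the shape of `hΔ`).
So of the hypotheses of `samePWitnessAt_of_kit₂'` at `S.Γ = cellGeom X C R a₀ anchor hanch` the purely geometric ones `hΓ hA hsep hX hSt hΔ hB`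
are all discharged (`hL` = the level geometry is the (I3) instance, separate file); what remains is probabilistic: `hQ0`, `hface`, `hreach`.

[cite: KozmaNitzan2024, §4 pp. 25–27 (Q_v, M_v, E_{v,x}, H^j_{v,x}, E_{i+1}) — the ℤ^d model] [cite: GrimmettPercolation1999, §7.2]
-/

noncomputable section

open scoped Classical

namespace Summit.CriticalPhenomena.PercolationContinuityZ3.Theorems

namespace Transplant

namespace BoxProdZ2

open Literature.Probability.Percolation Literature.Probability.LatticeModels SimpleGraph GadgetSystem Contour KNCells
open Literature.Barriers.CriticalPhenomena (graphBall graphBall_finite mem_graphBall_self graphBall_mono)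

variable {W : Type} (X : SimpleGraph W) [X.LocallyFinite]
variable (C : PCells) (R : ℕ) (a₀ : W) (anchor : W → Site 2 → Finset (Sym2 (W × Site 2)) → W)
  (hanch : ∀ a v P, anchor a v P ∈ ballFin X a R)

/-! ## §1 Admissible anchors -/

/-- **`AnchGeom`** for the `X □ ℤ²` cells: `a ∈ B_X(a, R)` and the admissible set `B_X(a, R)` does not depend on the macro-vertex. [folklore] -/
theorem anchGeom : AnchGeom (cellGeom X C R a₀ anchor hanch) where
  refl a _ := by change a ∈ ballFin X a R; rw [mem_ballFin]; exact mem_graphBall_self X a R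
  const _ _ _ := rfl

/-! ## §2 The cross-anchor containments of the lag-1 scheme -/

/-- An admissible anchor sees the original one: `a' ∈ B(a, R') ⇒ a ∈ B(a', R')`. [folklore] -/
theorem mem_ballFin_comm {a a' : W} {R' : ℕ} (ha' : a' ∈ ballFin X a R') : a ∈ ballFin X a' R' :=
  (mem_ballFin X).2 ((mem_graphBall_comm X).1 ((mem_ballFin X).1 ha'))

/-- `B(a, S) ⊆ B(a', T)` for `a' ∈ B(a, R')` and `R' + S ≤ T`. [folklore] -/
theorem ballFin_subset_of_mem' {a a' : W} {R' S T : ℕ} (ha' : a' ∈ ballFin X a R') (hST : R' + S ≤ T) : ballFin X a S ⊆ ballFin X a' T :=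
  ballFin_subset_of_mem X (mem_ballFin_comm X ha') hST

/-- **`SepGeom₂`** for the `X □ ℤ²` cells: p3-g2's `sepGeom` and the two cross-anchor containments
`Q^a_x ⊆ Cell^{a'}_x`, `Btw^a_{v,δ} ⊆ Cell^a_v ∪ Cell^{a'}_{v+δ}` for admissible `a' ∈ B_X(a, R)`. [cite: KozmaNitzan2024, §4 pp. 25–26] -/
theorem sepGeom₂ [DecidableEq W] : SepGeom₂ (X □ zdGraph 2) (cellGeom X C R a₀ anchor hanch) where
  toSepGeom := sepGeom X C R a₀ anchor hanch
  Q_subset_Cell₂ a a' x ha' := by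
    change ballFin X a (2 * R) ×ˢ C.Q x ⊆ ballFin X a' (3 * R) ×ˢ C.Cell x
    exact Finset.product_subset_product (ballFin_subset_of_mem' X ha' (by omega)) (C.Q_subset_Cell x)
  Btw_subset_Cells₂ a a' v δ ha' := by
    change ballFin X a R ×ˢ C.Btw v δ ⊆ ballFin X a (3 * R) ×ˢ C.Cell v ∪ ballFin X a' (3 * R) ×ˢ C.Cell (v + stepVec δ)
    exact product_subset_union (ballFin_mono X a (by omega)) (ballFin_subset_of_mem' X ha' (by omega)) (C.Btw_subset_Cells v δ)

/-! ## §3 The envelope bound -/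

/-- A centred planar square of half-width `w` has at most `(2w+1)²` points. [folklore] -/
theorem card_sq_le (v : Site 2) (w : ℕ) :
    (Finset.Icc (C.cen v - ((w : ℕ) : Site 2)) (C.cen v + ((w : ℕ) : Site 2))).card ≤ (2 * w + 1) ^ 2 := by
  refine KozmaNitzan.card_Icc_le_pow fun k => ?_
  simp only [Pi.add_apply, Pi.sub_apply, Pi.natCast_apply]
  omega

/-- `|Q_v| ≤ (10r+1)²`. [folklore] -/
theorem card_Q_le (v : Site 2) : (C.Q v).card ≤ (10 * C.r + 1) ^ 2 := by
  have h := card_sq_le C v (5 * C.r)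
  rw [PCells.Q]
  calc _ ≤ (2 * (5 * C.r) + 1) ^ 2 := h
    _ = (10 * C.r + 1) ^ 2 := by ring_nf

/-- `E_{w,δ}` lies in the square of half-width `35 r` around the centre of `w + δ`. [folklore] -/
theorem Ewv_subset_sq (w : Site 2) (δ : MDir) :
    C.Ewv w δ ⊆ Finset.Icc (C.cen (w + stepVec δ) - ((35 * C.r : ℕ) : Site 2)) (C.cen (w + stepVec δ) + ((35 * C.r : ℕ) : Site 2)) := by
  intro t ht
  rw [C.mem_sq_iff]
  intro i
  have h := abs_le.1 (sub_cen_le_of_mem_Ewv C ht i)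
  push_cast
  constructor <;> linarith [h.1, h.2]

/-- `|E_{w,δ}| ≤ (70r+1)²`. [folklore] -/
theorem card_Ewv_le (w : Site 2) (δ : MDir) : (C.Ewv w δ).card ≤ (70 * C.r + 1) ^ 2 := by
  calc (C.Ewv w δ).card ≤ _ := Finset.card_le_card (Ewv_subset_sq C w δ)
    _ ≤ (2 * (35 * C.r) + 1) ^ 2 := card_sq_le C _ _
    _ = (70 * C.r + 1) ^ 2 := by ring_nf

/-- A stub of level `< K` lies in `Q_v ∪ E_{v,δ}`. [folklore] -/
theorem Stub_subset_Q_union_Ewv (v : Site 2) (δ : MDir) {j : ℕ} (hj : j < C.K) : C.Stub v δ j ⊆ C.Q v ∪ C.Ewv v δ := by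
  intro t ht
  rcases Finset.mem_union.1 (C.Stub_subset_Q_union_Btw v δ hj ht) with h | h
  · exact Finset.mem_union_left _ h
  · exact Finset.mem_union_right _ (by rw [PCells.Ewv]; exact Finset.mem_union_left _ h)

/-- `|H^j_{v,δ}| ≤ (10r+1)² + (70r+1)²` for `j < K`. [folklore] -/
theorem card_Stub_le (v : Site 2) (δ : MDir) {j : ℕ} (hj : j < C.K) : (C.Stub v δ j).card ≤ (10 * C.r + 1) ^ 2 + (70 * C.r + 1) ^ 2 :=
  (Finset.card_le_card (Stub_subset_Q_union_Ewv C v δ hj)).trans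
    ((Finset.card_union_le _ _).trans (Nat.add_le_add (card_Q_le C v) (card_Ewv_le C v δ)))

/-- The anchored `E^a_{w,δ}` lies in `B_X(a, 2R) × E_{w,δ}`. [folklore] -/
theorem Ewv_cellGeom_subset [DecidableEq W] (a : W) (w : Site 2) (δ : MDir) :
    (cellGeom X C R a₀ anchor hanch).Ewv a w δ ⊆ ballFin X a (2 * R) ×ˢ C.Ewv w δ := by
  change ballFin X a R ×ˢ C.Btw w δ ∪ ballFin X a (2 * R) ×ˢ C.Q (w + stepVec δ) ⊆ ballFin X a (2 * R) ×ˢ C.Ewv w δ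
  intro u hu
  rw [PCells.Ewv, Finset.product_union]
  rcases Finset.mem_union.1 hu with h | h
  · exact Finset.mem_union_left _ (Finset.product_subset_product (ballFin_mono X a (by omega)) le_rfl h)
  · exact Finset.mem_union_right _ h

/-- `|E^a_{w,δ}| ≤ (Δ+1)^{2R} (70r+1)²`. [folklore] -/
theorem card_Ewv_cellGeom_le [DecidableEq W] {Δ : ℕ} (hΔ : ∀ w, X.degree w ≤ Δ) (a : W) (w : Site 2) (δ : MDir) :
    ((cellGeom X C R a₀ anchor hanch).Ewv a w δ).card ≤ (Δ + 1) ^ (2 * R) * (70 * C.r + 1) ^ 2 := by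
  calc _ ≤ (ballFin X a (2 * R) ×ˢ C.Ewv w δ).card := Finset.card_le_card (Ewv_cellGeom_subset X C R a₀ anchor hanch a w δ)
    _ = (ballFin X a (2 * R)).card * (C.Ewv w δ).card := Finset.card_product _ _
    _ ≤ (Δ + 1) ^ (2 * R) * (70 * C.r + 1) ^ 2 := Nat.mul_le_mul (card_ballFin_le X hΔ a _) (card_Ewv_le C w δ)

/-- `|Stub^{a'}_{x,du}(K-1)| ≤ (Δ+1)^R ((10r+1)² + (70r+1)²)`. [folklore] -/
theorem card_Stub_cellGeom_le [DecidableEq W] {Δ : ℕ} (hΔ : ∀ w, X.degree w ≤ Δ) (a' : W) (x : Site 2) (du : MDir) :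
    ((cellGeom X C R a₀ anchor hanch).Stub a' x du ((cellGeom X C R a₀ anchor hanch).K - 1)).card ≤
      (Δ + 1) ^ R * ((10 * C.r + 1) ^ 2 + (70 * C.r + 1) ^ 2) := by
  change (ballFin X a' R ×ˢ C.Stub x du (C.K - 1)).card ≤ _
  rw [Finset.card_product]
  have hK := C.hK
  exact Nat.mul_le_mul (card_ballFin_le X hΔ a' _) (card_Stub_le C x du (by omega))

/-- **The envelope bound `hB`** of `samePWitnessAt_of_kit₂'` for the `X □ ℤ²` cells: for EVERY history, macro-edge and pair of anchors,
`#envRegion₂ h e a a' ≤ (Δ+1)^{2R} (70r+1)² + 4 (Δ+1)^R ((10r+1)² + (70r+1)²)` (explicit, uniform). [cite: KozmaNitzan2024, §4 p. 27 (E_{i+1}) — the ℤ^d model] -/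
theorem card_envRegion₂_le [DecidableEq W] {Δ : ℕ} (hΔ : ∀ w, X.degree w ≤ Δ) (S : KSchA (W × Site 2) W)
    (hS : S.Γ = cellGeom X C R a₀ anchor hanch) (h : ProbeHistory (W × Site 2)) (e : Site 2 × MDir) (a a' : W) :
    (S.envRegion₂ (X □ zdGraph 2) h e a a').card ≤
      (Δ + 1) ^ (2 * R) * (70 * C.r + 1) ^ 2 + 4 * ((Δ + 1) ^ R * ((10 * C.r + 1) ^ 2 + (70 * C.r + 1) ^ 2)) := by
  rw [KSchA.envRegion₂]
  refine (Finset.card_union_le _ _).trans (Nat.add_le_add ?_ ?_)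
  · rw [hS]; exact card_Ewv_cellGeom_le X C R a₀ anchor hanch hΔ a e.1 e.2
  · calc _ ≤ (S.onward (X □ zdGraph 2) h (tgt e)).card * ((Δ + 1) ^ R * ((10 * C.r + 1) ^ 2 + (70 * C.r + 1) ^ 2)) :=
          Finset.card_biUnion_le_card_mul _ _ _ fun du _ => by rw [hS]; exact card_Stub_cellGeom_le X C R a₀ anchor hanch hΔ a' _ du
      _ ≤ 4 * ((Δ + 1) ^ R * ((10 * C.r + 1) ^ 2 + (70 * C.r + 1) ^ 2)) := by
          refine Nat.mul_le_mul_right _ ?_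
          calc (S.onward (X □ zdGraph 2) h (tgt e)).card ≤ (Finset.univ : Finset MDir).card := Finset.card_le_univ _
            _ = 4 := by simp [MDir]

/-- The envelope bound in the existential shape. [folklore] -/
theorem exists_card_envRegion₂_le [DecidableEq W] {Δ : ℕ} (hΔ : ∀ w, X.degree w ≤ Δ) (S : KSchA (W × Site 2) W)
    (hS : S.Γ = cellGeom X C R a₀ anchor hanch) :
    ∃ B : ℕ, ∀ (h : ProbeHistory (W × Site 2)) (e : Site 2 × MDir) (a a' : W), (S.envRegion₂ (X □ zdGraph 2) h e a a').card ≤ B :=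
  ⟨_, card_envRegion₂_le X C R a₀ anchor hanch hΔ S hS⟩

/-! ## §4 The degree bound -/

omit [X.LocallyFinite] in
/-- **The degree bound `hΔ`** of `samePWitnessAt_of_kit₂'` for `X □ ℤ²`: `deg ≤ Δ + 4` (p2's `ProdKN.degree_prod_le`). [folklore] -/
theorem degree_le [DecidableEq W] [X.LocallyFinite] {Δ : ℕ} (hΔ : ∀ w, X.degree w ≤ Δ) : ∀ x : W × Site 2, (X □ zdGraph 2).degree x ≤ Δ + 4 :=
  ProdKN.degree_prod_le X hΔ

/-! ## §5 The entry-anchor geometry -/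

/-- `AnchGeom` for the entry-anchor cells. [folklore] -/
theorem anchGeom_entry [DecidableEq W] : AnchGeom (entryCellGeom X C R a₀) := anchGeom X C R a₀ _ _

/-- `SepGeom₂` for the entry-anchor cells. [cite: KozmaNitzan2024, §4 pp. 25–26] -/
theorem sepGeom₂_entry [DecidableEq W] : SepGeom₂ (X □ zdGraph 2) (entryCellGeom X C R a₀) := sepGeom₂ X C R a₀ _ _

/-- The envelope bound for the entry-anchor cells. [cite: KozmaNitzan2024, §4 p. 27 (E_{i+1})] -/
theorem card_envRegion₂_le_entry [DecidableEq W] {Δ : ℕ} (hΔ : ∀ w, X.degree w ≤ Δ) (S : KSchA (W × Site 2) W)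
    (hS : S.Γ = entryCellGeom X C R a₀) (h : ProbeHistory (W × Site 2)) (e : Site 2 × MDir) (a a' : W) :
    (S.envRegion₂ (X □ zdGraph 2) h e a a').card ≤
      (Δ + 1) ^ (2 * R) * (70 * C.r + 1) ^ 2 + 4 * ((Δ + 1) ^ R * ((10 * C.r + 1) ^ 2 + (70 * C.r + 1) ^ 2)) :=
  card_envRegion₂_le X C R a₀ _ _ hΔ S hS h e a a'

end BoxProdZ2

end Transplant

end Summit.CriticalPhenomena.PercolationContinuityZ3.Theorems

end
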